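import Summits.CriticalPhenomena.SAWScalingLimit.Theses.SAWReversalUpgrade

/-!
# Objects of the boundary attachment of route `SAWReversalUpgrade` (item `AttachReversal`)

The route `SAWReversalUpgrade` (items `ForwardDriving`, `AttachReversal`, `FaithfulOfNoReturn`,
`AttachmentExists`, `AttachNoReturn`) speaks about the CANONICAL BOUNDARY ATTACHMENT of a lattice
polyline in a Dobrushin domain `(D; a, b)` through one long `let`-block (trim the polyline at its last
visit of `a` and first visit of `b`; push it into `D` by the angular squeeze
`A_e : r e^{iθ} ↦ r e^{i(e + (1 - 2e/π) θ)}` in uniformizing coordinates; join `a`, `b` along the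
boundary-most crossings of the access segment / exit ray). This file names the members of that
`let`-block as definitions, parametrised by the marked points `a b : ℂ`, the boundary extension
`Φ : ℂ → ℂ` of the uniformizer, the squeeze angle `e : ℝ` and the extended polyline `R : ℝ → ℂ`, so
that the proof files of the item can state lemmas about them; `attachReversal_iff`
records (by `Iff.rfl`) that the route's `let`-blocks ARE these definitions.

Nothing is asserted here beyond definitional unfoldings.
-/

noncomputable section

open Set Function
open Literature.Probability.RandomPlanarGeometry Literature.Probability.LatticeModels

namespace Summit.CriticalPhenomena.SAWScalingLimit.Theorems.AttachReversal

/-- The angular squeeze `A_e : z = r e^{iθ} ↦ r e^{i(e + (1 - 2e/π) θ)}` (route `SAWReversalUpgrade`,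
`let A₁ := …`). -/
def squeeze (e : ℝ) (z : ℂ) : ℂ :=
  (‖z‖ : ℂ) * Complex.exp (Complex.I * ((e : ℂ) + (1 - 2 * (e : ℂ) / (Real.pi : ℂ)) * (Complex.arg z : ℂ)))

/-- The inverse `ψ₁ := Function.invFunOn Φ {z | 0 ≤ im z}` of a boundary extension `Φ` on the closed
upper half-plane (route `SAWReversalUpgrade`, `let ψ₁ := …`). -/
def hinv (Φ : ℂ → ℂ) : ℂ → ℂ :=
  Function.invFunOn Φ {z : ℂ | 0 ≤ z.im}

/-- A parametrised curve extended to all real times by `Set.projIcc` (route `SAWReversalUpgrade`,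
`let R₁ := fun u : ℝ => P₁ (Set.projIcc 0 1 zero_le_one u)`). -/
def projLine (P : C(unitInterval, ℂ)) : ℝ → ℂ :=
  fun u : ℝ => P (Set.projIcc (0:ℝ) 1 zero_le_one u)

/-- The pushed polyline `Z₁ u := if R u = b then b else Φ (A_e (ψ₁ (R u)))` (route `SAWReversalUpgrade`,
`let Z₁ := …`). -/
def attZ (b : ℂ) (Φ : ℂ → ℂ) (e : ℝ) (R : ℝ → ℂ) : ℝ → ℂ :=
  fun u : ℝ => @ite ℂ (R u = b) (Classical.propDecidable _) b (Φ (squeeze e (hinv Φ (R u))))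

/-- The last visit time `i₁` of `a` (or `0`) (route `SAWReversalUpgrade`, `let i₁ := …`). -/
def lastA (a : ℂ) (R : ℝ → ℂ) : ℝ :=
  sSup ({(0:ℝ)} ∪ {u | u ∈ Set.Icc (0:ℝ) 1 ∧ R u = a})

/-- The first visit time `j₁` of `b` (or `1`) (route `SAWReversalUpgrade`, `let j₁ := …`). -/
def firstB (b : ℂ) (R : ℝ → ℂ) : ℝ :=
  sInf ({(1:ℝ)} ∪ {u | u ∈ Set.Icc (0:ℝ) 1 ∧ R u = b})

/-- The pushed middle arc `M₁ := Z₁ '' [i₁, j₁]` (route `SAWReversalUpgrade`, `let M₁ := …`). -/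
def midSet (a b : ℂ) (Φ : ℂ → ℂ) (e : ℝ) (R : ℝ → ℂ) : Set ℂ :=
  attZ b Φ e R '' Set.Icc (lastA a R) (firstB b R)

/-- The direction `p₁ := A_e (ψ₁ (R i₁))` of the access segment (route `SAWReversalUpgrade`). -/
def pAcc (a : ℂ) (Φ : ℂ → ℂ) (e : ℝ) (R : ℝ → ℂ) : ℂ :=
  squeeze e (hinv Φ (R (lastA a R)))

/-- The direction `q₁ := A_e (ψ₁ (R j₁))` of the exit ray (route `SAWReversalUpgrade`). -/
def qEx (b : ℂ) (Φ : ℂ → ℂ) (e : ℝ) (R : ℝ → ℂ) : ℂ :=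
  squeeze e (hinv Φ (R (firstB b R)))

/-- The boundary-most crossing parameter `s₁` of the access segment (route `SAWReversalUpgrade`). -/
def sAcc (a b : ℂ) (Φ : ℂ → ℂ) (e : ℝ) (R : ℝ → ℂ) : ℝ :=
  sInf {s | s ∈ Set.Ioc (0:ℝ) 1 ∧ Φ ((s : ℂ) * pAcc a Φ e R) ∈ midSet a b Φ e R}

/-- The boundary-most crossing parameter `r₁` of the exit ray (route `SAWReversalUpgrade`). -/
def rEx (a b : ℂ) (Φ : ℂ → ℂ) (e : ℝ) (R : ℝ → ℂ) : ℝ :=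
  sSup ({(1:ℝ)} ∪ {r | 1 ≤ r ∧ R (firstB b R) ≠ b ∧ Φ ((r : ℂ) * qEx b Φ e R) ∈ midSet a b Φ e R})

/-- The cut time `u₁` (first visit of the access crossing by `Z₁`) (route `SAWReversalUpgrade`). -/
def uMid (a b : ℂ) (Φ : ℂ → ℂ) (e : ℝ) (R : ℝ → ℂ) : ℝ :=
  sInf {u | u ∈ Set.Icc (lastA a R) (firstB b R) ∧
    attZ b Φ e R u = Φ ((sAcc a b Φ e R : ℂ) * pAcc a Φ e R)}

/-- The cut time `v₁` (last visit of the exit crossing by `Z₁`, or `j₁`) (route `SAWReversalUpgrade`). -/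
def vMid (a b : ℂ) (Φ : ℂ → ℂ) (e : ℝ) (R : ℝ → ℂ) : ℝ :=
  sSup ({u | u ∈ Set.Icc (lastA a R) (firstB b R) ∧ R (firstB b R) = b ∧ u = firstB b R} ∪
    {u | u ∈ Set.Icc (lastA a R) (firstB b R) ∧ R (firstB b R) ≠ b ∧
      attZ b Φ e R u = Φ ((rEx a b Φ e R : ℂ) * qEx b Φ e R)})

/-- The prescribed trace `S₁` of the attached curve (route `SAWReversalUpgrade`, `let S₁ := …`). -/
def attSet (a b : ℂ) (Φ : ℂ → ℂ) (e : ℝ) (R : ℝ → ℂ) : Set ℂ :=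
  ((({a, b} ∪ ((fun s : ℝ => Φ ((s : ℂ) * pAcc a Φ e R)) '' Set.Ioc 0 (sAcc a b Φ e R))) ∪
    (attZ b Φ e R '' Set.Icc (uMid a b Φ e R) (vMid a b Φ e R))) ∪
    ((fun r : ℝ => Φ ((r : ℂ) * qEx b Φ e R)) '' {r | rEx a b Φ e R ≤ r ∧ R (firstB b R) ≠ b}))

/-- The fallback trace `{a, b} ∪ Φ(iℝ₊)` (route `SAWReversalUpgrade`). -/
def fallback (a b : ℂ) (Φ : ℂ → ℂ) : Set ℂ :=
  {a, b} ∪ ((fun y : ℝ => Φ (Complex.I * (y : ℂ))) '' Set.Ioi 0)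

/-- The set of STANDARD ATTACHMENTS for the data `(a, b, Φ, e, R)` in the domain `Ω`: the curves `c`
satisfying the conjunction that closes each attachment `let`-block of route `SAWReversalUpgrade`
(injective, from `a` to `b`, interior in `Ω`, with the prescribed trace). -/
def standardCurves (a b : ℂ) (Φ : ℂ → ℂ) (e : ℝ) (R : ℝ → ℂ) (Ω : Set ℂ) : Set (Curve ℂ) :=
  {c | Function.Injective c ∧ c.source = a ∧ c.target = b ∧ (∀ t : unitInterval, c t = a ∨ c t = b ∨ c t ∈ Ω) ∧
    (uMid a b Φ e R < vMid a b Φ e R → Set.range c = attSet a b Φ e R) ∧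
    (¬ uMid a b Φ e R < vMid a b Φ e R → Set.range c = fallback a b Φ)}

/-- The route item `AttachReversal`, read through the definitions of this file (definitional). -/
theorem attachReversal_iff :
    Theses.SAWReversalUpgrade.AttachReversal ↔
      ∀ (D : DobrushinDomain) (φ : ConformalEquiv UpperHalfPlane.upperHalfPlaneSet D.carrier),
        D.IsChordalUniformizing φ →
        ∀ (φ' : ConformalEquiv UpperHalfPlane.upperHalfPlaneSet D.swap.carrier),
          D.swap.IsChordalUniformizing φ' →
          ∀ (δ : ℝ) (u v : Site 2) (γ : SAW.DomainSAW D.carrier δ u v) (c c' : Curve ℂ), 0 < δ →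
            c ∈ standardCurves (D.pt 0) (D.pt 1) φ.boundaryExtension (min δ (1/2))
              (projLine (γ.walk.toCurve (meshPoint δ))) D.carrier →
            c' ∈ standardCurves (D.swap.pt 0) (D.swap.pt 1) φ'.boundaryExtension (min δ (1/2))
              (projLine (γ.walk.reverse.toCurve (meshPoint δ))) D.swap.carrier →
            CurveClass.mk c' = (CurveClass.mk c).reverse :=
  Iff.rfl

end Summit.CriticalPhenomena.SAWScalingLimit.Theorems.AttachReversal

end
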